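import Summits.ABC.IUTFork.Joshi.ArithmeticoidCollationOrd
import Mathlib.Topology.Instances.ZMod
import Mathlib.Data.ZMod.Basic

/-!
# [J-II½] Prop. 7.5.1 — NON-VACUITY WITNESS for the N-vs-W valuation dichotomy (proof-only; a toy factor, no claim)

Proof-only file of the abc-iut cell, branch E (rung LADDER-ABC:A2.E; seat abc-iut-E-t38); companion of
`Joshi/ArithmeticoidCollationPowers.lean` / `…Ord.lean`. **No side is taken** on [IUTchIII] Cor. 3.12, on Joshi's claims, or on
Mochizuki's report on them; a toy model exhibits satisfiability of hypotheses only.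

WHAT IS PROVED. The hypotheses of the dichotomy lemmas (`pow_mem_collationAll_ord`: compact Hausdorff topological-monoid standard
factors with a bijective `u`-th power map; `exists_ord_eq_of_mem_collationProvided_std`: `CohPreservesOrd`) are SIMULTANEOUSLY
satisfiable and the dichotomy is STRICT in a model: one place, one point, trivial local Galois group (so `coh` = identity and
`CohPreservesOrd` holds), every cohomology factor `= ℤ/5` written multiplicatively with the discrete topology (finite, hence compact
Hausdorff; a stand-in for the pro-`p` group `H^1(G_{L_v}, ℤ_p(1))` of [J-II½] Prop. 7.2.2 (2) truncated to one level), `ord` = identity,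
`u = 2` (a unit mod `5`, so squaring is bijective — as `u` prime to `p` is on `ℤ_p`). Then for the class `c = 1 ∈ ℤ/5`
(multiplicatively `ofAdd 1`): `c^2` lies in the W-collation of `{c}` over `A = {y₀}` but NOT in its N-collation
(`Toy5.sq_mem_collationAll_not_mem_collationProvided`). Standard axioms only; sorry-free. [claim: Joshi2023ATS2half, status: disputed]
-/

set_option autoImplicit false

noncomputable section

open Set

namespace Summit.ABC.IUTFork.Joshi.ATS2half

namespace Toy5

/-- One place, one point. [folklore] -/
abbrev Pt : Unit → Type := fun _ => Unit

/-- Every cohomology factor is `ℤ/5`, written multiplicatively, with the discrete topology. [folklore] -/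
abbrev H : ℕ → (v : Unit) → Pt v → Type := fun _ _ _ => Multiplicative (ZMod 5)

/-- Trivial local Galois groups. [folklore] -/
abbrev G : (v : Unit) → Pt v → Type := fun _ _ => Unit

/-- Value groups: the factor itself (`ord` = identity). [folklore] -/
abbrev Λ : Unit → Type := fun _ => Multiplicative (ZMod 5)

/-- The toy cohomology datum (`coh` = identity on the unique anabelomorphism of the trivial group). [folklore] -/
def datum : CohomologyDatum (Pt := Pt) H (∅ : Set Unit) G where
  canonicalFibre _ := Set.univ
  std _ := ()
  std_mem _ _ := Set.mem_univ _
  coh _ _ _ _ _ := ContinuousMulEquiv.refl _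

/-- `ord` = identity. [folklore] -/
def ord : ∀ (v : Unit) (y : Pt v), H 1 v y →* Λ v := fun _ _ => MonoidHom.id _

/-- `CohPreservesOrd` holds in the toy (the only anabelomorphism-induced isomorphism is the identity). [folklore] -/
theorem cohPreservesOrd : datum.CohPreservesOrd ord := fun _ _ _ _ _ => rfl

/-- In `ℤ/5` (multiplicatively) every element has `x^5 = 1`. [folklore] -/
theorem pow_five (x : Multiplicative (ZMod 5)) : x ^ 5 = 1 := by
  rw [← ofAdd_toAdd x, ← ofAdd_nsmul, nsmul_eq_mul]
  simp only [Nat.cast_ofNat]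
  rw [show (5 : ZMod 5) = 0 from by decide, zero_mul, ofAdd_zero]

/-- Squaring is bijective on `ℤ/5` (its inverse is cubing: `2·3 = 6 ≡ 1`) — the toy stand-in for «`x ↦ x^u` is bijective on a
pro-`p` group for `u` prime to `p`». [folklore] -/
theorem sq_bijective : Function.Bijective fun x : Multiplicative (ZMod 5) => x ^ 2 := by
  refine Function.bijective_iff_has_inverse.2 ⟨fun x => x ^ 3, fun x => ?_, fun x => ?_⟩
  · show (x ^ 2) ^ 3 = x
    rw [← pow_mul, show 2 * 3 = 5 + 1 from rfl, pow_succ, pow_five, one_mul]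
  · show (x ^ 3) ^ 2 = x
    rw [← pow_mul, show 3 * 2 = 5 + 1 from rfl, pow_succ, pow_five, one_mul]

/-- The class `c = 1 ∈ ℤ/5` (multiplicatively) at the unique place. [folklore] -/
def c : CohArith H 1 datum.std := fun _ => Multiplicative.ofAdd (1 : ZMod 5)

/-- `c^2 ≠ c` in the unique factor (`2 ≠ 1` in `ℤ/5`): squaring changes the «valuation». [folklore] -/
theorem ord_sq_ne : (ord () () (c ())) ^ 2 ≠ ord () () (c ()) := by
  simp only [ord, c, MonoidHom.id_apply, ← ofAdd_nsmul]
  decide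

/-- **The dichotomy is strict in the toy**: over `A = {y₀}` with `Ψ_{y₀} = {c}`, the square `c^2` IS W-collated (reading «all the
isomorphisms (of topological groups) of each factor») and is NOT N-collated (reading «provided by Prop. 7.4.1» = induced by
anabelomorphisms), because N-collated classes keep the valuation profile of their source while `ord(c^2) ≠ ord(c)`. [folklore] -/
theorem sq_mem_collationAll_not_mem_collationProvided :
    c ^ 2 ∈ datum.collationAll 1 {datum.std} (fun _ => {c}) ∧
      c ^ 2 ∉ datum.collationProvided 1 {datum.std} (fun _ => {c}) := by
  refine ⟨(datum.pow_mem_collationAll_ord ord (A := {datum.std}) (Ψ := fun _ => {c}) rfl rfl 2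
    (fun _ => sq_bijective)).1, fun hN => ?_⟩
  obtain ⟨c', hc', hord⟩ := datum.exists_ord_eq_of_mem_collationProvided_std cohPreservesOrd hN
  have hc'c : c' = c := hc'
  subst hc'c
  exact datum.ord_pow_ne ord c 2 ord_sq_ne (hord ())

end Toy5

end Summit.ABC.IUTFork.Joshi.ATS2half

end
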